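import Literature.Computability.Cryptography.RegevSamplerOracleDesc
import Literature.Computability.QuantumComplexity.TidyDesc
import Literature.Computability.QuantumComplexity.UniformAbstract
import HarnessLib

/-!
# Regev 2009, Lemma 3.14 in machine form: the oracle solver's tidy block word on codes

Topic `Computability/Cryptography` (family `pqc`), grouping namespace `Regev2009.SamplerSubst`; stage S2(b) of the
uniformity of the inner machine. By `SamplerSubst.map_toAG_stageCirc_std` (`RegevSamplerOracleDesc.lean`) and
`TidyBlockFn.map_toAG_tidyCirc` (`QuantumComplexity/TidyDesc.lean`) the two occurrences of the uniform CVP solver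
`R` in the oracle stage abstract to the word
`T̂ = (tidyA kq (n·bc) (R.ancillas kq) ((R.circ kq).gates.map toAG)).map (AGmap (subA Lq oU oS kq (n·bc) oA base))`.
This file computes `T̂` ON CODES from the seven layout numbers (`kq`, `n·bc` in unary — the solver runs at query
length `kq` — the others in binary): **`oracleWordA_codeFP_of`**, by chaining

* `QCircuitFamily.abstract_codeFP_of_isUniform` / `ancillas_codeFP_of_isUniform` (`UniformAbstract.lean`: a uniform
  oracle-free family's abstract word and ancilla count are computed on codes from `1ᵏ`),
* `TidyBlockFn.tidyA_codeFP` (here repackaged context-generically as **`tidyA_codeFP_of`**),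
* `SamplerSubst.subA_codeFP_of` and `AJLCore.mapAGmap_codeFP` (`StageAbstract.lean`).

Everything is proved; no named fact is introduced; not the named fact `regev2009_lemma_3_14_stepFamily`.

## References

* O. Regev, *On lattices, learning with errors, random linear codes, and cryptography*, J. ACM 56 (2009),
  art. 34, Lemma 3.14 (proof: the oracle call) [Regev2009].
* S. Arora, B. Barak, *Computational Complexity: A Modern Approach*, CUP 2009, §6.2 and proof of Thm. 6.15;
  §1.3 [AroraBarak2009].
* C. H. Bennett, *Logical reversibility of computation*, IBM J. Res. Dev. 17 (1973), §2 [Bennett1973].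
-/

noncomputable section

namespace Literature.Computability.QuantumComplexity.TidyBlockFn

open _root_.Computability Cryptography Complexity Complexity.CodeFP AJLCore

/-- **The abstract tidy block on codes, context-generically**: sizes `k, ℓ` in unary, the dirty-ancilla count `d` in
binary and the inner word `SA` computed from a context `c`. [cite: Bennett1973, §2] [cite: AroraBarak2009, §6.2] -/
theorem tidyA_codeFP_of {σ : Type} {eσ : σ → List Bool} {k ℓ d : σ → ℕ} {SA : σ → List AG}
    (hk : CodeFP eσ unE k) (hℓ : CodeFP eσ unE ℓ) (hd : CodeFP eσ natE d) (hS : CodeFP eσ (rawE agE0) SA) :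
    CodeFP eσ (rawE agE0) (fun c => tidyA (k c) (ℓ c) (d c) (SA c)) := by
  have hcap : CodeFP eσ unE (fun c => k c + ℓ c) := (unAdd.comp (hk.pair hℓ) :)
  have hctx : CodeFP eσ (pairE (pairE unE (pairE natE (pairE natE natE))) (rawE agE0))
      (fun c => ((k c + ℓ c, (k c, (ℓ c, d c))), SA c)) :=
    (hcap.pair ((natOfUn.comp hk).pair ((natOfUn.comp hℓ).pair hd))).pair hS
  refine ((tidyA_codeFP.comp hctx).congr fun c => ?_)
  show tidyA (min (k c) (k c + ℓ c)) (min (ℓ c) (k c + ℓ c)) (d c) (SA c) = tidyA (k c) (ℓ c) (d c) (SA c)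
  rw [min_eq_left (Nat.le_add_right _ _), min_eq_left (Nat.le_add_left _ _)]

end Literature.Computability.QuantumComplexity.TidyBlockFn

namespace Literature.Computability.Cryptography.Regev2009.SamplerSubst

open _root_.Computability Literature.Computability.QuantumComplexity Literature.Computability.QuantumComplexity.AJLCore
  Literature.Computability.Complexity Literature.Computability.Complexity.CodeFP TidyBlockFn

/-- **The solver's own abstract word at the query length, on codes** (from the context's unary `kq`).
[cite: AroraBarak2009, §6.2 and proof of Thm. 6.15] -/
theorem solverA_codeFP_of {σ : Type} {eσ : σ → List Bool} (Rf : UniformQCircuitFamily) {kq : σ → ℕ} (hkq : CodeFP eσ unE kq) :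
    CodeFP eσ (rawE agE0) (fun c => ((Rf.family.circ (kq c)).gates.map toAG)) :=
  ((QCircuitFamily.abstract_codeFP_of_isUniform Rf.family Rf.isUniform Rf.isOracleFree).comp hkq :)

/-- The solver's ancilla count at the query length, on codes (binary). [cite: AroraBarak2009, §6.2] -/
theorem solverAnc_codeFP_of {σ : Type} {eσ : σ → List Bool} (Rf : UniformQCircuitFamily) {kq : σ → ℕ} (hkq : CodeFP eσ unE kq) :
    CodeFP eσ natE (fun c => Rf.family.ancillas (kq c)) :=
  (natOfUn.comp ((QCircuitFamily.ancillas_codeFP_of_isUniform Rf.family Rf.isUniform).comp hkq) :)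

/-- **The tidy block word of the solver, on codes.** [cite: Regev2009, Lemma 3.14 (proof: the oracle call)]
[cite: Bennett1973, §2] -/
theorem tidySolverA_codeFP_of {σ : Type} {eσ : σ → List Bool} (Rf : UniformQCircuitFamily) {kq nbc : σ → ℕ}
    (hkq : CodeFP eσ unE kq) (hnbc : CodeFP eσ unE nbc) :
    CodeFP eσ (rawE agE0) (fun c => tidyA (kq c) (nbc c) (Rf.family.ancillas (kq c)) ((Rf.family.circ (kq c)).gates.map toAG)) :=
  tidyA_codeFP_of hkq hnbc (solverAnc_codeFP_of Rf hkq) (solverA_codeFP_of Rf hkq)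

/-- **The oracle word `T̂` of the machine's oracle stage, on codes**: the solver's tidy block word placed by `subA`.
Context: the seven layout numbers, `kq` and `n·bc` in unary, the rest in binary.
[cite: Regev2009, Lemma 3.14 (proof: the oracle call)] [cite: AroraBarak2009, §6.2 and proof of Thm. 6.15] -/
theorem oracleWordA_codeFP_of {σ : Type} {eσ : σ → List Bool} (Rf : UniformQCircuitFamily)
    {Lq oU oS kq nbc oA base : σ → ℕ} (hLq : CodeFP eσ natE Lq) (hoU : CodeFP eσ natE oU) (hoS : CodeFP eσ natE oS)
    (hkq : CodeFP eσ unE kq) (hnbc : CodeFP eσ unE nbc) (hoA : CodeFP eσ natE oA) (hbase : CodeFP eσ natE base) :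
    CodeFP eσ (rawE agE0) (fun c =>
      (tidyA (kq c) (nbc c) (Rf.family.ancillas (kq c)) ((Rf.family.circ (kq c)).gates.map toAG)).map
        (AGmap (subA (Lq c) (oU c) (oS c) (kq c) (nbc c) (oA c) (base c)))) := by
  have hsub : CodeFP (pairE eσ natE) natE
      (fun q => subA (Lq q.1) (oU q.1) (oS q.1) (kq q.1) (nbc q.1) (oA q.1) (base q.1) q.2) :=
    subA_codeFP_of hLq hoU hoS (natOfUn.comp hkq :) (natOfUn.comp hnbc :) hoA hbase
  have hmap : ∀ {L : σ → List AG}, CodeFP eσ (rawE agE0) L →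
      CodeFP eσ (rawE agE0) (fun c => (L c).map (AGmap (subA (Lq c) (oU c) (oS c) (kq c) (nbc c) (oA c) (base c)))) :=
    fun hL => ((mapAGmap_codeFP (f := fun c w => subA (Lq c) (oU c) (oS c) (kq c) (nbc c) (oA c) (base c) w) hsub).comp
      ((CodeFP.id _).pair hL)).congr fun _ => rfl
  exact hmap (tidySolverA_codeFP_of Rf hkq hnbc)

/-- **Specialised to a layout**: with `kq = Lq + n·ℓR` and the offsets of `Λ` read off a context computing them, the
`T̂` segments of `map_toAG_stageCirc_std` are computed on codes. [cite: Regev2009, Lemma 3.14 (proof)] -/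
theorem oracleWordA_codeFP_layout {σ : Type} {eσ : σ → List Bool} (Rf : UniformQCircuitFamily) {W n : σ → ℕ}
    (Λ : (c : σ) → SamplerClassical.Layout (W c) (n c))
    (hLq : CodeFP eσ natE fun c => (Λ c).Lq) (hoU : CodeFP eσ natE fun c => (Λ c).oU) (hoS : CodeFP eσ natE fun c => (Λ c).oS)
    (hkq : CodeFP eσ unE fun c => (Λ c).kq) (hnbc : CodeFP eσ unE fun c => n c * (Λ c).bc)
    (hoA : CodeFP eσ natE fun c => (Λ c).oA) (hbase : CodeFP eσ natE fun c => (Λ c).base) :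
    CodeFP eσ (rawE agE0) (fun c =>
      (tidyA (Λ c).kq (n c * (Λ c).bc) (Rf.family.ancillas (Λ c).kq) ((Rf.family.circ (Λ c).kq).gates.map toAG)).map
        (AGmap (subA (Λ c).Lq (Λ c).oU (Λ c).oS (Λ c).kq (n c * (Λ c).bc) (Λ c).oA (Λ c).base))) :=
  oracleWordA_codeFP_of Rf hLq hoU hoS hkq hnbc hoA hbase

end Literature.Computability.Cryptography.Regev2009.SamplerSubst

end
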